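import Summits.CriticalPhenomena.PercolationContinuityZ3.Theorems.Transplant.PlanarSkeletonFrmFromDefs
import HarnessLib

/-!
# The SCALED one-type node at the end of the skeleton ladder: `PlanarSkeletonFrmScaled` = frames only, an `L`-Lipschitz chart,
# EXACT STEPS OF LENGTH `N`, cylinders connected from some width on; the drop node `SamePDropOfSkeletonFrmScaled₁` (`@[conjecture]`, OPEN)

builds on p205010 (kernel theorem, internal audit signed; external expert review pending) — nothing in this file uses p205010; NOTHING is claimed
about any node (N2 `SamePDropOfSkeletonFrm₁`, U `SamePDropOfSkeletonFrmFrom₁` and the node typed here are OPEN `Prop`s of this programme).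
Lane `prim-bschramm`, seat `prim-bschramm-p4` gen 16 (PART C3 of `P4-GENERAL.md` §38: INPUT(G) as weak as possible — ARBITRARY GENERATING SETS).
Helper file (`--supports stmt-CriticalPhenomena-4575 --as helper`).  DEFINITIONS + immediate reductions only.

WHY (P4-GENERAL §38).  Every Cayley-graph row of the C3 class map so far needs a UNIT-RANGE additive chart `φ : Γ → ℤ²` with unit steps in `S`
(`CayleyFrm₃`, `NilFrm.Data`: "any unit-range alphabet").  A generating set with TALL letters in every direction (`Cay(ℤ³; ±eᵢ, ±2eᵢ)`,
`Cay(H₃; a, b, a⁵)`, a generic finite symmetric `S ⊂ ℤ³`) has NO such chart, and coarsening a chart (`⌊φ/N⌋`) makes the carrier MULTI-TYPE —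
which the design owners' ruling N2-SCOPE (A4)/(R-6) excludes from every frames-only node ("types may prefer different quadrants").  The cure that
keeps ONE type is to keep the FINE chart and carry two integers instead: after re-basing `φ` on a pair of generator images of MAXIMAL AREA
(file `SiteTwoMaxArea`), EVERY finitely generated `Cay(Γ; S)` with an additive rank-2 chart has `‖φ(s)‖_∞ ≤ N` on `S` and generators `u₀, u₁`
with `φ(uᵢ) = N·eᵢ` EXACTLY (file `CayleySkeletonScaled`).  This file types the corresponding interface and node:
* `PlanarSkeletonFrmScaled G` — `PlanarSkeletonFrmFrom` (10 fields) with `lip` relaxed to `|φ u i − φ v i| ≤ L` along edges and `step` changed to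
  EXACT steps `φ v' = φ v + N σ eᵢ` along single edges (`1 ≤ N`); cylinders `cyl`, Φ2 `CylSubcritical` verbatim (fine units); the forgetful map
  `PlanarSkeletonFrmFrom.toFrmScaled` (`L = N = 1`); quasi-transitivity; **`p_c < 1` from the `N`-steps alone** (`criticalProb_lt_one_frmScaled`:
  the COARSE chart `v ↦ ⌊φ v / N⌋` has unit steps, so Benjamini–Schramm Thm 1 / Kesten apply through `Skelφ.criticalProb_lt_one_of_steps`);
* **`SamePDropOfSkeletonFrmScaled₁`** (OPEN): the one-type drop node over it — same body as `SamePDropOfSkeletonFrmFrom₁`; it implies U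
  (`samePDropOfSkeletonFrmFrom₁_of_frmScaled₁`), hence N2, D″(κ′) and N1's statement; normal form `…_iff_critical`; the customers' one-liner
  `continuity_of_frmScaledNode₁`.  Intended proof: an N2 closure with every length measured in units of `N` and every Lipschitz use of the chart
  multiplied by `L` (a re-parametrisation; no new probabilistic step is visible — but it is NOT typed and nothing is claimed).
CUSTOMERS (files `CayleySkeletonScaled`, `CayleyScaledCustomers`, conditional on this node): `Cay(Γ; S)` for EVERY finite generating `S` of every
group `Γ` with an additive `φ : Γ → ℤ²` of rank-2 image and finitely generated kernel — in particular EVERY Cayley graph of `ℤ³` and of `H₃(ℤ)`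
(there Φ2 is free: quasi-one-dimensional cylinders) and every Cayley graph of every finitely generated nilpotent group (Φ2 pending).
[cite: KozmaNitzan2024, §1 p. 2 (approach 1); §4 pp. 15–17 (Lemma 8, the role of the lattice symmetries)] [cite: BenjaminiSchramm1996, Conj. 4; Thm. 1]
[cite: MartineauTassion2017, §3.2]
-/

noncomputable section

namespace Summit.CriticalPhenomena.PercolationContinuityZ3.Theorems.Transplant

open MeasureTheory Literature.Probability.Percolation Literature.Probability.LatticeModels
open Literature.Barriers.CriticalPhenomena (IsQuasiTransitive IsGraphAmenable HasExponentialGrowth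
  hasExponentialGrowth_of_not_isGraphAmenable Hutchcroft2016_noPercolationAtCriticality_holds BurtonKeane1989_atMostOneInfiniteCluster_holds
  countable_of_connected_of_locallyFinite)
open scoped Classical

/-- **Planar skeleton with translating frames only, an `L`-Lipschitz chart, exact steps of length `N` and cylinders connected from some width on**
(interface of the scaled one-type node): `PlanarSkeletonFrmFrom` with `lip` relaxed to Lipschitz constant `L` and (ι) replaced by EXACT steps
`φ v' = φ v + N σ eᵢ` along single edges.  No point symmetry. [cite: KozmaNitzan2024, §4 p. 16 (Lemma 8)] [cite: MartineauTassion2017, §3.2] -/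
structure PlanarSkeletonFrmScaled {V : Type} (G : SimpleGraph V) [G.LocallyFinite] where
  /-- the skeleton map `φ : V → ℤ²` (fine units) -/
  φ : V → Site 2
  /-- the Lipschitz constant of the chart -/
  L : ℕ
  /-- `φ` is `L`-Lipschitz in the sup-norm along edges -/
  lip : ∀ ⦃u v : V⦄, G.Adj u v → ∀ i : Fin 2, |φ u i - φ v i| ≤ L
  /-- finitely many base vertices (one per frame type) -/
  types : Finset V
  /-- FRAMES: every vertex is the image of a base vertex under an automorphism translating the skeleton -/
  frame : ∀ v : V, ∃ t ∈ types, ∃ α : G ≃g G, α t = v ∧ ∀ w, φ (α w) = φ w + (φ v - φ t)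
  /-- (μ) a degree bound -/
  Δ : ℕ
  /-- every vertex has degree `≤ Δ` -/
  degree_le : ∀ v : V, G.degree v ≤ Δ
  /-- the step length -/
  N : ℕ
  /-- the step length is positive -/
  one_le_N : 1 ≤ N
  /-- (ι_N) EXACT steps of length `N` in every skeleton direction at every vertex, along single edges -/
  step : ∀ (v : V) (i : Fin 2) (σ : ℤˣ), ∃ v' : V, G.Adj v v' ∧ φ v' = φ v + Pi.single i ((N : ℤ) * σ)
  /-- (κ′) the width from which on cylinders are connected -/
  ℓ₀ : ℕ
  /-- (κ′) the graph induced on each cylinder of half-width `ℓ ≥ ℓ₀` at a base vertex is connected -/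
  cyl_connected : ∀ t ∈ types, ∀ ℓ : ℕ, ℓ₀ ≤ ℓ → (G.induce {w | φ w - φ t ∈ box 2 ℓ}).Connected

namespace PlanarSkeletonFrmScaled

variable {V : Type} {G : SimpleGraph V} [G.LocallyFinite] (Φ : PlanarSkeletonFrmScaled G)

/-- Cylinder of half-width `ℓ` at `t` (fine units). [cite: KozmaNitzan2024, §4 p. 15 (boxes)] -/
def cyl (t : V) (ℓ : ℕ) : Set V := {w | Φ.φ w - Φ.φ t ∈ box 2 ℓ}

/-- **Input Φ2 at density `p`**: the induced graph of every cylinder (EVERY width) at a base vertex has `θ = 0` at `p`.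
[cite: MartineauSevero2019, Cor. 2.2] -/
def CylSubcritical (p : unitInterval) : Prop :=
  ∀ t ∈ Φ.types, ∀ ℓ : ℕ,
    theta (G.induce (Φ.cyl t ℓ)) ⟨t, show Φ.φ t - Φ.φ t ∈ box 2 ℓ by rw [sub_self]; exact zero_mem_box 2 ℓ⟩ p = 0

/-- Frames with finitely many types make a `PlanarSkeletonFrmScaled` graph quasi-transitive (the inverse frame carries `v` into `types`).
[cite: Hutchcroft2016, §1 (finitely many Aut(G)-orbits)] -/
theorem isQuasiTransitive_frmScaled (Φ : PlanarSkeletonFrmScaled G) : IsQuasiTransitive G :=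
  ⟨Φ.types, fun v => by
    obtain ⟨t, ht, α, hαt, -⟩ := Φ.frame v
    exact ⟨α.symm, by rw [← hαt, RelIso.symm_apply_apply]; exact ht⟩⟩

/-- **The coarse chart** `v ↦ ⌊φ v / N⌋` (componentwise Euclidean quotient). [folklore] -/
def coarse (v : V) : Site 2 := fun i => Φ.φ v i / (Φ.N : ℤ)

/-- **The `N`-steps of `φ` are UNIT steps of the coarse chart** (`⌊(a + Nσ)/N⌋ = ⌊a/N⌋ + σ`). [folklore] -/
theorem steps_coarse (Φ : PlanarSkeletonFrmScaled G) : Skelφ.Steps G Φ.coarse := by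
  intro v i σ
  obtain ⟨v', hv', hφ⟩ := Φ.step v i σ
  refine ⟨v', hv', funext fun j => ?_⟩
  have hN : (Φ.N : ℤ) ≠ 0 := by have := Φ.one_le_N; omega
  show Φ.φ v' j / (Φ.N : ℤ) = Φ.φ v j / (Φ.N : ℤ) + (Pi.single i (σ : ℤ) : Site 2) j
  rw [hφ, Pi.add_apply]
  by_cases hj : j = i
  · subst hj
    rw [Pi.single_eq_same, Pi.single_eq_same, mul_comm, Int.add_mul_ediv_right _ _ hN]
  · rw [Pi.single_eq_of_ne hj, Pi.single_eq_of_ne hj, add_zero, add_zero]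

/-- **`p_c < 1` at every vertex of a connected `PlanarSkeletonFrmScaled` graph (from the `N`-steps alone)**: the coarse chart is a weak covering of
`ℤ²`, so `p_c(G, t) ≤ p_c(ℤ²) = ½`. [cite: BenjaminiSchramm1996, Thm. 1] -/
theorem criticalProb_lt_one_frmScaled (Φ : PlanarSkeletonFrmScaled G) (hc : G.Connected) (t : V) : criticalProb G t < 1 :=
  haveI : Countable V := countable_of_connected_of_locallyFinite G hc t
  Skelφ.criticalProb_lt_one_of_steps Φ.steps_coarse t

end PlanarSkeletonFrmScaled

namespace PlanarSkeletonFrmFrom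

variable {V : Type} {G : SimpleGraph V} [G.LocallyFinite] (Φ : PlanarSkeletonFrmFrom G)

/-- **Every `PlanarSkeletonFrmFrom` is a `PlanarSkeletonFrmScaled`** with `L = N = 1`. [folklore] -/
def toFrmScaled : PlanarSkeletonFrmScaled G where
  φ := Φ.φ
  L := 1
  lip := fun u v h i => by rw [Nat.cast_one]; exact Φ.lip h i
  types := Φ.types
  frame := Φ.frame
  Δ := Φ.Δ
  degree_le := Φ.degree_le
  N := 1
  one_le_N := le_rfl
  step := fun v i σ => by
    obtain ⟨v', hv', hφ⟩ := Φ.step v i σ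
    exact ⟨v', hv', by rw [hφ, Nat.cast_one, one_mul]⟩
  ℓ₀ := Φ.ℓ₀
  cyl_connected := Φ.cyl_connected

/-- The base vertices of `toFrmScaled` are those of the skeleton. [folklore] -/
@[simp] theorem toFrmScaled_types : Φ.toFrmScaled.types = Φ.types := rfl

/-- The chart of `toFrmScaled` is that of the skeleton. [folklore] -/
@[simp] theorem toFrmScaled_φ : Φ.toFrmScaled.φ = Φ.φ := rfl

/-- The cylinders of `toFrmScaled` are those of the skeleton. [folklore] -/
@[simp] theorem toFrmScaled_cyl (t : V) (ℓ : ℕ) : Φ.toFrmScaled.cyl t ℓ = Φ.cyl t ℓ := rfl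

/-- Cylinder subcriticality is the same statement for `toFrmScaled`. [folklore] -/
theorem cylSubcritical_toFrmScaled_iff (p : unitInterval) : Φ.toFrmScaled.CylSubcritical p ↔ Φ.CylSubcritical p := Iff.rfl

end PlanarSkeletonFrmFrom

/-- TARGET (OPEN — a `Prop`, never asserted; NOT in print): **THE SCALED ONE-TYPE NODE** — the drop node over planar skeletons with translating
frames only, an `L`-Lipschitz chart, exact steps of length `N` and cylinders connected from some width on.  For every connected, locally finite,
countable `G` with a ONE-TYPE `PlanarSkeletonFrmScaled` (`types = {t}`), every density `p < 1`: a.s. uniqueness at `p`, `CylSubcritical p` and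
`θ_t(p) > 0` give `θ_t(q) > 0` at some `q < p`.  It implies the universal one-type node U (`samePDropOfSkeletonFrmFrom₁_of_frmScaled₁`), hence N2,
D″(κ′) and N1's statement; the converse direction is its open content.  Intended proof: an N2 / U closure with box sides, strides and corridor
widths measured in units of `N` and every Lipschitz estimate multiplied by `L` (P4-GENERAL §38; a re-parametrisation, untyped, nothing claimed).
[cite: KozmaNitzan2024, §1 p. 2 (approach 1), §4 pp. 15–31] [cite: BenjaminiSchramm1996, Conj. 4] [cite: MartineauTassion2017, §3.2] -/
@[conjecture] def SamePDropOfSkeletonFrmScaled₁ : Prop :=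
  ∀ {V : Type} [DecidableEq V] [Countable V] (G : SimpleGraph V) [G.LocallyFinite] (Φ : PlanarSkeletonFrmScaled G),
    G.Connected → ∀ t ∈ Φ.types, Φ.types = {t} → ∀ p : unitInterval, (p : ℝ) < 1 →
      (∀ᵐ ω ∂bondPercolation G p, numInfiniteClusters ω ≤ 1) → Φ.CylSubcritical p → 0 < theta G t p →
        ∃ q : unitInterval, (q : ℝ) < p ∧ 0 < theta G t q

/-- **The scaled node implies the universal one-type node U** (forget that `L = N = 1`). [folklore] -/
theorem samePDropOfSkeletonFrmFrom₁_of_frmScaled₁ (h : SamePDropOfSkeletonFrmScaled₁) : SamePDropOfSkeletonFrmFrom₁ :=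
  fun G _ Φ hc t ht h1 p hp hU hC hθ => h G Φ.toFrmScaled hc t (by rwa [PlanarSkeletonFrmFrom.toFrmScaled_types])
    (by rw [PlanarSkeletonFrmFrom.toFrmScaled_types, h1]) p hp hU ((PlanarSkeletonFrmFrom.cylSubcritical_toFrmScaled_iff Φ p).2 hC) hθ

/-- **The scaled node implies the frames-only node N2.** [folklore] -/
theorem samePDropOfSkeletonFrm₁_of_frmScaled₁ (h : SamePDropOfSkeletonFrmScaled₁) : SamePDropOfSkeletonFrm₁ :=
  samePDropOfSkeletonFrm₁_of_frmFrom₁ (samePDropOfSkeletonFrmFrom₁_of_frmScaled₁ h)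

/-- **The scaled node implies the CLOSED one-type `{±1}` node's statement.** [folklore] -/
theorem samePDropOfSkeletonNeg₁_of_frmScaled₁ (h : SamePDropOfSkeletonFrmScaled₁) : SamePDropOfSkeletonNeg₁ :=
  samePDropOfSkeletonNeg₁_of_frmFrom₁ (samePDropOfSkeletonFrmFrom₁_of_frmScaled₁ h)

/-- **Normal form at criticality**: the scaled node has content at `p = p_c` only. [cite: BenjaminiSchramm1996, Conj. 4] -/
theorem samePDropOfSkeletonFrmScaled₁_iff_critical : SamePDropOfSkeletonFrmScaled₁ ↔
    ∀ {V : Type} [DecidableEq V] [Countable V] (G : SimpleGraph V) [G.LocallyFinite] (Φ : PlanarSkeletonFrmScaled G),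
      G.Connected → ∀ t ∈ Φ.types, Φ.types = {t} → criticalProb G t < 1 →
        (∀ᵐ ω ∂bondPercolation G (criticalProbIOf G t), numInfiniteClusters ω ≤ 1) →
          Φ.CylSubcritical (criticalProbIOf G t) → theta G t (criticalProbIOf G t) = 0 := by
  constructor
  · intro hD V _ _ G _ Φ hc t ht h1 hpc hU hC
    exact theta_criticalProbIOf_eq_zero_of_drop_at G t fun hpos => hD G Φ hc t ht h1 _ (by exact hpc) hU hC hpos
  · intro hK V _ _ G _ Φ hc t ht h1 p hp1 hU hC hθ
    have hge : criticalProb G t ≤ p :=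
      not_lt.1 fun hlt => hθ.ne' (theta_eq_zero_of_lt_criticalProb_holds G t p hlt)
    rcases hge.lt_or_eq with hlt | heq
    · have hpc0 : 0 ≤ criticalProb G t := (criticalProb_mem_Icc G t).1
      have hp0 : 0 ≤ (p : ℝ) := p.2.1
      have hq1 : (criticalProb G t + p) / 2 ≤ 1 := by linarith [p.2.2]
      refine ⟨⟨(criticalProb G t + p) / 2, by positivity, hq1⟩, ?_, ?_⟩
      · show (criticalProb G t + (p : ℝ)) / 2 < p
        linarith
      · exact theta_pos_of_criticalProb_lt_holds G t _
          (by show criticalProb G t < (criticalProb G t + (p : ℝ)) / 2; linarith)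
    · exfalso
      have e : p = criticalProbIOf G t := Subtype.ext heq.symm
      subst e
      exact hθ.ne' (hK G Φ hc t ht h1 (by exact hp1) hU hC)

/-- **Conditional continuity from the scaled node** (the customers' one-liner): on a connected locally finite graph with a one-type
`PlanarSkeletonFrmScaled` and subcritical cylinders at `p_c`, `θ_t(p_c) = 0` — countability, quasi-transitivity, uniqueness (Hutchcroft off
amenability, Burton–Keane on it) and `p_c < 1` come from the skeleton. [cite: BenjaminiSchramm1996, Conj. 4] [cite: Hutchcroft2016, Thm. 1]
[cite: LyonsPeres2016, Thm. 7.6] -/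
theorem continuity_of_frmScaledNode₁ (hD : SamePDropOfSkeletonFrmScaled₁) {V : Type} (G : SimpleGraph V) [G.LocallyFinite]
    (Φ : PlanarSkeletonFrmScaled G) (hc : G.Connected) (t : V) (ht : t ∈ Φ.types) (h1 : Φ.types = {t})
    (hC : Φ.CylSubcritical (criticalProbIOf G t)) : theta G t (criticalProbIOf G t) = 0 := by
  haveI : Countable V := countable_of_connected_of_locallyFinite G hc t
  have hq : IsQuasiTransitive G := Φ.isQuasiTransitive_frmScaled
  by_cases hg : HasExponentialGrowth G
  · exact Hutchcroft2016_noPercolationAtCriticality_holds G hc hq hg t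
  · have ha : IsGraphAmenable G := by_contra fun hna => hg (hasExponentialGrowth_of_not_isGraphAmenable G hq hna)
    exact samePDropOfSkeletonFrmScaled₁_iff_critical.1 hD G Φ hc t ht h1 (Φ.criticalProb_lt_one_frmScaled hc t)
      (BurtonKeane1989_atMostOneInfiniteCluster_holds G hc hq ha _) hC

/-- **… at EVERY vertex** (frames are automorphisms: `θ` and `p_c` are transported from the base vertex). [cite: BenjaminiSchramm1996, Conj. 4] -/
theorem continuity_of_frmScaledNode₁' (hD : SamePDropOfSkeletonFrmScaled₁) {V : Type} (G : SimpleGraph V) [G.LocallyFinite]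
    (Φ : PlanarSkeletonFrmScaled G) (hc : G.Connected) (t : V) (ht : t ∈ Φ.types) (h1 : Φ.types = {t})
    (hC : Φ.CylSubcritical (criticalProbIOf G t)) (v : V) : theta G v (criticalProbIOf G v) = 0 := by
  haveI : Countable V := countable_of_connected_of_locallyFinite G hc t
  have hbase := continuity_of_frmScaledNode₁ hD G Φ hc t ht h1 hC
  obtain ⟨t', ht', α, hαt, -⟩ := Φ.frame v
  rw [h1, Finset.mem_singleton] at ht'
  subst ht'
  have hθ := theta_iso α t' (criticalProbIOf G t')
  have hpc := criticalProb_iso α t'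
  rw [hαt] at hθ hpc
  have e : criticalProbIOf G v = criticalProbIOf G t' := Subtype.ext hpc
  rw [e, hθ]
  exact hbase

end Summit.CriticalPhenomena.PercolationContinuityZ3.Theorems.Transplant

end
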